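import Summits.CriticalPhenomena.PercolationContinuityZ3.Theorems.PercNearOneGluingNoHeavyLowerTailThreePointProductFormFibreForestBridges
import Summits.CriticalPhenomena.PercolationContinuityZ3.Theorems.PercNearOneGluingNoHeavyLowerTailThreePointProductFormFibreCutVertex
import HarnessLib

/-!
# The forest form of the halving lemma, III: the bridgeless skeleton and the contracted multigraph
# (Sahi programme, prover prim-sahi-p2 gen 58)

Support file (`--supports stmt-CriticalPhenomena-4575`, helper); part of THEOREM A of the memos
`run/shared/lean/prim/prim-sahi/FROM-prim-sahi-p2-gen57-FOREST-FORM.md` §2 and `…gen58-…` §3: the forest form (FOR) of the halving lemma on the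
contractions `H/N₀` of a finite labelled multigraph `H = (V, α, ends)` implies `#bad ≤ #P1 + #P2` (FIB-v) on `H`.  Standard axioms, no sorries,
no named facts, no definitions (everything spelled out inline).

Objects.  A configuration is `z : α → Bool`; `R z x y := (openGraph (labelledOpen ends z)).Reachable x y`.  An open label `l` of `z` with
`ends l = s(x, y)` is a BRIDGE of `z` when `¬ R (update z l false) x y`, a NON-BRIDGE otherwise.  The SKELETON class of `zN : α → Bool` is the set of
`z` whose open non-bridges are exactly the open labels of `zN`, written with the two hypotheses
`hsk : ∀ l, zN l = true → z l = true ∧ (∀ x y, ends l = s(x,y) → R (update z l false) x y)` and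
`hbr : ∀ l, zN l = false → z l = true → ∀ x y, ends l = s(x,y) → ¬ R (update z l false) x y`.
The CONTRACTION `H/zN` has vertices the connected components of `openGraph (labelledOpen ends zN)` (Mathlib `SimpleGraph.ConnectedComponent`),
labels `{l // zN l = false}` and endpoint map `l ↦ (ends l).map π` (`π = connectedComponentMk`); the restriction of `z` is `fun l => z l.1`.
* `reachable_closed_of_bridge` [this work] — closing a bridge `l'` of `z` does not disconnect the endpoints of another open label `l` in `z − l`.
* **`skeleton_closed`** [this work] — in a skeleton class, every skeleton label has its endpoints joined inside the skeleton minus itself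
  (all bridges of `z` can be closed at once without disconnecting the endpoints of a non-bridge).
* `reachable_quotient_of_reachable`, `reachable_of_reachable_quotient` [this work] — projection / lifting of connections between `H` and `H/zN`.
* `flat_quotient_apply`, **`reachable_flat_quotient`** [this work] — the flat `♭z = clusterFlip ends a z̄` restricts to the flat of the restriction,
  so `bad_H(z) ⟹ bad_{H/zN}(z|)`.
* **`forest_restrict_of_skeleton`** [this work] — the restriction of a member of the skeleton class of `zN` is a FOREST configuration of `H/zN`.
* **`extension_skeleton`**, **`extension_bridge`** [this work] — conversely, extending a forest configuration of `H/zN` by the (closed) skeleton `zN`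
  gives a member of the skeleton class (skeleton labels open non-bridges; open non-skeleton labels bridges).
[folklore] (walks, closed sets, quotient graphs); [cite: Gladkov2024, Conjecture 10.1 (p. 18), arXiv:2408.08457] for the conjectures served.
-/

namespace Summit.CriticalPhenomena.PercolationContinuityZ3.Theorems.ProductFormFibre

open Finset Literature.Probability.Percolation
open Summit.CriticalPhenomena.PercolationContinuityZ3.Theorems (TransplantRecipes.mem_of_walk TransplantRecipes.mem_of_reachable)
open Summit.CriticalPhenomena.PercolationContinuityZ3.Theorems.ThreePointCPIClusterSwap
  (QTouch clusterFlip clusterFlip_of_qtouch clusterFlip_of_not_qtouch)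

variable {V α : Type*}

section ForestSkeleton

variable (ends : α → Sym2 V)

/-! ### 1. Bridges and the closedness of the skeleton -/

/-- An open label joins its endpoints. [folklore] -/
theorem reachable_of_label (z : α → Bool) {l : α} {x y : V} (hl : ends l = s(x, y)) (hz : z l = true) :
    (openGraph (labelledOpen ends z)).Reachable x y := by
  by_cases hxy : x = y
  · subst hxy; exact SimpleGraph.Reachable.refl x
  · exact SimpleGraph.Adj.reachable ((adj_labelled_iff ends z x y).2 ⟨⟨l, hz, hl⟩, hxy⟩)

/-- **Closing a bridge keeps the endpoints of the other open labels joined in `z − l`.**  If `l ≠ l'` are labels, `l` open in `z` with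
`ends l = s(x,y)`, `l'` a bridge of `z` (`ends l' = s(p,q)`, `p ↮ q` once `l'` is closed) and `x ↔ y` in `z − l`, then `x ↔ y` in `z − l − l'`.
[this work] -/
theorem reachable_closed_of_bridge [DecidableEq α] (z : α → Bool) {l l' : α} (hne : l' ≠ l) {x y p q : V}
    (hl : ends l = s(x, y)) (hl' : ends l' = s(p, q)) (hzl : z l = true)
    (hbr : ¬ (openGraph (labelledOpen ends (Function.update z l' false))).Reachable p q)
    (hxy : (openGraph (labelledOpen ends (Function.update z l false))).Reachable x y) :
    (openGraph (labelledOpen ends (Function.update (Function.update z l false) l' false))).Reachable x y := by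
  set w := Function.update z l false with hw
  by_cases hwl' : w l' = true
  · -- `w = update (update w l' false) l' true`
    have hrw : Function.update (Function.update w l' false) l' true = w := by
      funext b; by_cases hb : b = l'
      · subst hb; simp [hwl']
      · simp [Function.update_of_ne hb]
    have hxy' : (openGraph (labelledOpen ends (Function.update (Function.update w l' false) l' true))).Reachable x y := by
      rw [hrw]; exact hxy
    have hsplit := reachable_update_true_split ends (Function.update w l' false) hl' hxy'
    have hback : Function.update (Function.update w l' false) l' false = Function.update w l' false := by
      funext b; by_cases hb : b = l'
      · subst hb; simp
      · simp [Function.update_of_ne hb]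
    rw [hback] at hsplit
    -- `x ↔ y` in `z − l'` by the label `l` itself
    have hl_open : Function.update z l' false l = true := by rw [Function.update_of_ne (Ne.symm hne)]; exact hzl
    have hxyz : (openGraph (labelledOpen ends (Function.update z l' false))).Reachable x y :=
      reachable_of_label ends _ hl hl_open
    -- `w − l' ≤ z − l'`
    have hmono : ∀ b, Function.update w l' false b = true → Function.update z l' false b = true := by
      intro b hb
      by_cases hb' : b = l'
      · subst hb'; simp at hb
      · rw [Function.update_of_ne hb'] at hb ⊢
        by_cases hbl : b = l
        · subst hbl; simp [hw] at hb
        · rw [hw, Function.update_of_ne hbl] at hb; exact hb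
    rcases hsplit with h0 | ⟨h1, h2⟩ | ⟨h1, h2⟩
    · exact h0
    · exact absurd ((reachable_of_le ends hmono h1).symm.trans (hxyz.trans (reachable_of_le ends hmono h2).symm)) hbr
    · exact absurd (((reachable_of_le ends hmono h2).trans hxyz.symm).trans (reachable_of_le ends hmono h1)) hbr
  · -- `l'` already closed in `w`
    have hrw : Function.update w l' false = w := by
      funext b; by_cases hb : b = l'
      · subst hb; simp; cases h : w b <;> simp_all
      · simp [Function.update_of_ne hb]
    rw [hrw]; exact hxy

/-- **The skeleton is closed.**  If the open non-bridges of `z` are exactly the open labels of `zN`, then every open label of `zN` has its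
endpoints joined in `zN` minus that label (closing all bridges of `z` at once does not disconnect the endpoints of a non-bridge). [this work] -/
theorem skeleton_closed [Fintype α] [DecidableEq α] (z zN : α → Bool)
    (hsk : ∀ l, zN l = true → z l = true ∧
      ∀ x y, ends l = s(x, y) → (openGraph (labelledOpen ends (Function.update z l false))).Reachable x y)
    (hbr : ∀ l, zN l = false → z l = true →
      ∀ x y, ends l = s(x, y) → ¬ (openGraph (labelledOpen ends (Function.update z l false))).Reachable x y)
    {l : α} (hl : zN l = true) {x y : V} (hxy : ends l = s(x, y)) :
    (openGraph (labelledOpen ends (Function.update zN l false))).Reachable x y := by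
  classical
  -- the bridges of `z`
  set B : Finset α := univ.filter (fun b => zN b = false ∧ z b = true) with hB
  -- closing a set `S ⊆ B` of bridges
  have key : ∀ S : Finset α, S ⊆ B →
      (openGraph (labelledOpen ends (Function.update (fun b => if b ∈ S then false else z b) l false))).Reachable x y := by
    intro S
    induction S using Finset.induction_on with
    | empty =>
      intro _
      have h0 : (fun b => if b ∈ (∅ : Finset α) then false else z b) = z := by funext b; simp
      rw [h0]; exact (hsk l hl).2 x y hxy
    | @insert l' S hl'S ih =>
      intro hsub
      have hS : S ⊆ B := fun b hb => hsub (Finset.mem_insert_of_mem hb)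
      have hl'B : l' ∈ B := hsub (Finset.mem_insert_self l' S)
      have hl'B' : zN l' = false ∧ z l' = true := by simpa [hB] using hl'B
      set c : α → Bool := fun b => if b ∈ S then false else z b with hc
      have hins : (fun b => if b ∈ insert l' S then false else z b) = Function.update c l' false := by
        funext b; by_cases hb : b = l'
        · subst hb; simp
        · simp [hc, Finset.mem_insert, hb]
      rw [hins, Function.update_comm]
      · -- apply the bridge lemma to the configuration `c`
        have hne : l' ≠ l := by rintro rfl; rw [hl] at hl'B'; exact Bool.noConfusion hl'B'.1
        have hlB : l ∉ S := by
          intro hlS; have := hS hlS; simp [hB, hl] at this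
        have hcl : c l = true := by simp [hc, hlB, (hsk l hl).1]
        obtain ⟨⟨p, q⟩, hpq⟩ := Quot.exists_rep (ends l')
        have hl'e : ends l' = s(p, q) := hpq.symm
        have hbr' : ¬ (openGraph (labelledOpen ends (Function.update c l' false))).Reachable p q := by
          intro h
          refine hbr l' hl'B'.1 hl'B'.2 p q hl'e (reachable_of_le ends (fun b hb => ?_) h)
          by_cases hb' : b = l'
          · subst hb'; simp at hb
          · rw [Function.update_of_ne hb'] at hb ⊢
            by_cases hbS : b ∈ S
            · simp [hc, hbS] at hb
            · simpa [hc, hbS] using hb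
        exact reachable_closed_of_bridge ends c hne hxy hl'e hcl hbr' (ih hS)
      · rintro rfl; rw [hl] at hl'B'; exact Bool.noConfusion hl'B'.1
  have hfin := key B (subset_refl B)
  have hcB : (fun b => if b ∈ B then false else z b) = zN := by
    funext b
    by_cases hb : zN b = true
    · have : b ∉ B := by simp [hB, hb]
      simp [this, (hsk b hb).1, hb]
    · have hb' : zN b = false := by cases h : zN b <;> simp_all
      by_cases hzb : z b = true
      · have : b ∈ B := by simp [hB, hb', hzb]
        simp [this, hb']
      · have hzb' : z b = false := by cases h : z b <;> simp_all
        have : b ∉ B := by simp [hB, hzb']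
        simp [this, hzb', hb']
  rw [hcB] at hfin
  exact hfin

/-! ### 2. The contracted multigraph `H/zN`: projection and lifting of connections -/

/-- **Projection.**  Every connection of `z` in `H` projects to a connection of the restriction of `z` in the contraction `H/zN`
(no hypothesis on `z`: a step along a skeleton label stays inside one contracted vertex). [this work] -/
theorem reachable_quotient_of_reachable (z zN : α → Bool) {x y : V} (h : (openGraph (labelledOpen ends z)).Reachable x y) :
    (openGraph (labelledOpen
        (fun l : {l // zN l = false} => (ends l.1).map (openGraph (labelledOpen ends zN)).connectedComponentMk)
        (fun l => z l.1))).Reachable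
      ((openGraph (labelledOpen ends zN)).connectedComponentMk x) ((openGraph (labelledOpen ends zN)).connectedComponentMk y) := by
  set GN := openGraph (labelledOpen ends zN) with hGN
  set ends' : {l // zN l = false} → Sym2 GN.ConnectedComponent := fun l => (ends l.1).map GN.connectedComponentMk with hends'
  refine TransplantRecipes.mem_of_reachable (G := openGraph (labelledOpen ends z))
    (S := {v | (openGraph (labelledOpen ends' (fun l => z l.1))).Reachable (GN.connectedComponentMk x) (GN.connectedComponentMk v)})
    (SimpleGraph.Reachable.refl _) ?_ h
  intro u w hu hadj
  rw [adj_labelled_iff] at hadj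
  obtain ⟨⟨b, hb, hbe⟩, huw⟩ := hadj
  by_cases hNb : zN b = true
  · -- a skeleton label: same contracted vertex
    have hadjN : GN.Adj u w := (adj_labelled_iff ends zN u w).2 ⟨⟨b, hNb, hbe⟩, huw⟩
    have heq : GN.connectedComponentMk u = GN.connectedComponentMk w :=
      SimpleGraph.ConnectedComponent.connectedComponentMk_eq_of_adj hadjN
    show (openGraph (labelledOpen ends' (fun l => z l.1))).Reachable (GN.connectedComponentMk x) (GN.connectedComponentMk w)
    rw [← heq]; exact hu
  · have hNb' : zN b = false := by cases h' : zN b <;> simp_all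
    have hbe' : ends' ⟨b, hNb'⟩ = s(GN.connectedComponentMk u, GN.connectedComponentMk w) := by
      simp [hends', hbe]
    have hstep : (openGraph (labelledOpen ends' (fun l => z l.1))).Reachable (GN.connectedComponentMk u) (GN.connectedComponentMk w) :=
      reachable_of_label ends' (fun l => z l.1) hbe' hb
    exact SimpleGraph.Reachable.trans hu hstep

/-- **Lifting.**  If every skeleton label is open in `z`, every connection of the restriction in `H/zN` lifts to a connection of `z` in `H`.
[this work] -/
theorem reachable_of_reachable_quotient (z zN : α → Bool) (hN : ∀ l, zN l = true → z l = true) {x y : V}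
    (h : (openGraph (labelledOpen
        (fun l : {l // zN l = false} => (ends l.1).map (openGraph (labelledOpen ends zN)).connectedComponentMk)
        (fun l => z l.1))).Reachable
      ((openGraph (labelledOpen ends zN)).connectedComponentMk x) ((openGraph (labelledOpen ends zN)).connectedComponentMk y)) :
    (openGraph (labelledOpen ends z)).Reachable x y := by
  set GN := openGraph (labelledOpen ends zN) with hGN
  set ends' : {l // zN l = false} → Sym2 GN.ConnectedComponent := fun l => (ends l.1).map GN.connectedComponentMk with hends'
  -- vertices in one contracted vertex are joined in `z`
  have hblock : ∀ u w : V, GN.connectedComponentMk u = GN.connectedComponentMk w → (openGraph (labelledOpen ends z)).Reachable u w := by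
    intro u w huw
    exact reachable_of_le ends hN (SimpleGraph.ConnectedComponent.exact huw)
  have key := TransplantRecipes.mem_of_reachable (G := openGraph (labelledOpen ends' (fun l => z l.1)))
    (S := {Y | ∀ w, GN.connectedComponentMk w = Y → (openGraph (labelledOpen ends z)).Reachable x w})
    (v := GN.connectedComponentMk x) (u := GN.connectedComponentMk y) (fun w hw => (hblock w x hw).symm) ?_ h
  · exact key y rfl
  intro Y W hY hadj
  rw [adj_labelled_iff] at hadj
  obtain ⟨⟨b, hb, hbe⟩, hYW⟩ := hadj
  obtain ⟨⟨u₀, v₀⟩, h₀⟩ := Quot.exists_rep (ends b.1)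
  have he : ends b.1 = s(u₀, v₀) := h₀.symm
  have hmap : s(GN.connectedComponentMk u₀, GN.connectedComponentMk v₀) = s(Y, W) := by
    rw [← hbe]; simp [hends', he]
  have hlab : (openGraph (labelledOpen ends z)).Reachable u₀ v₀ := reachable_of_label ends z he hb
  intro w hw
  rcases Sym2.eq_iff.1 hmap with ⟨h1, h2⟩ | ⟨h1, h2⟩
  · exact ((hY u₀ h1).trans hlab).trans (hblock v₀ w (h2.trans hw.symm))
  · exact ((hY v₀ h2).trans hlab.symm).trans (hblock u₀ w (h1.trans hw.symm))

/-- Restricting commutes with closing / opening a non-skeleton label. [folklore] -/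
theorem restrict_update [DecidableEq α] (z zN : α → Bool) {b : α} (hb : zN b = false) (v : Bool) :
    (fun l : {l // zN l = false} => Function.update z b v l.1) = Function.update (fun l : {l // zN l = false} => z l.1) ⟨b, hb⟩ v := by
  funext l
  by_cases hl : l = ⟨b, hb⟩
  · subst hl; simp
  · have hl' : l.1 ≠ b := fun h => hl (Subtype.ext h)
    rw [Function.update_of_ne hl, Function.update_of_ne hl']

/-- **The flat restricts to the flat.**  If every skeleton label is open in `z`, then on the non-skeleton labels the flat
`♭z = clusterFlip ends a z̄` of `H` coincides with the flat of the restriction in `H/zN` (apex = the contracted vertex of `a`). [this work] -/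
theorem flat_quotient_apply [DecidableEq V] (z zN : α → Bool) (hN : ∀ l, zN l = true → z l = true) (a : V) (b : α) (hb : zN b = false) :
    clusterFlip (fun l : {l // zN l = false} => (ends l.1).map (openGraph (labelledOpen ends zN)).connectedComponentMk)
        ((openGraph (labelledOpen ends zN)).connectedComponentMk a) (fun l => !z l.1) ⟨b, hb⟩ =
      clusterFlip ends a (fun l => !z l) b := by
  classical
  set GN := openGraph (labelledOpen ends zN) with hGN
  set ends' : {l // zN l = false} → Sym2 GN.ConnectedComponent := fun l => (ends l.1).map GN.connectedComponentMk with hends'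
  have hq : QTouch ends' (GN.connectedComponentMk a) (fun x => !(fun l : {l // zN l = false} => z l.1) x) ⟨b, hb⟩ ↔
      QTouch ends a (fun x => !z x) b := by
    refine (qtouch_compl_iff ends' (GN.connectedComponentMk a) (fun l => z l.1) ⟨b, hb⟩).trans
      (Iff.trans ?_ (qtouch_compl_iff ends a z b).symm)
    constructor
    · rintro ⟨X, hX, hr⟩
      have hX' : X ∈ Sym2.map GN.connectedComponentMk (ends b) := by simpa [hends'] using hX
      obtain ⟨u, hu, rfl⟩ := Sym2.mem_map.1 hX'
      exact ⟨u, hu, reachable_of_reachable_quotient ends z zN hN hr⟩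
    · rintro ⟨u, hu, hr⟩
      refine ⟨GN.connectedComponentMk u, ?_, reachable_quotient_of_reachable ends z zN hr⟩
      show GN.connectedComponentMk u ∈ Sym2.map GN.connectedComponentMk (ends b)
      exact Sym2.mem_map.2 ⟨u, hu, rfl⟩
  by_cases h : QTouch ends a (fun x => !z x) b
  · rw [clusterFlip_of_qtouch ends a _ h, clusterFlip_of_qtouch ends' (GN.connectedComponentMk a) _ (hq.2 h)]
  · rw [clusterFlip_of_not_qtouch ends a _ h, clusterFlip_of_not_qtouch ends' (GN.connectedComponentMk a) _ (fun h' => h (hq.1 h'))]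

/-- **`bad_H ⟹ bad_{H/zN}`** (connection part).  If every skeleton label is open in `z`, a connection of the flat `♭z` in `H` projects to
a connection of the flat of the restriction in `H/zN`. [this work] -/
theorem reachable_flat_quotient [DecidableEq V] (z zN : α → Bool) (hN : ∀ l, zN l = true → z l = true) (a : V) {x y : V}
    (h : (openGraph (labelledOpen ends (clusterFlip ends a fun l => !z l))).Reachable x y) :
    (openGraph (labelledOpen
        (fun l : {l // zN l = false} => (ends l.1).map (openGraph (labelledOpen ends zN)).connectedComponentMk)
        (clusterFlip (fun l : {l // zN l = false} => (ends l.1).map (openGraph (labelledOpen ends zN)).connectedComponentMk)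
          ((openGraph (labelledOpen ends zN)).connectedComponentMk a) (fun l => !z l.1)))).Reachable
      ((openGraph (labelledOpen ends zN)).connectedComponentMk x) ((openGraph (labelledOpen ends zN)).connectedComponentMk y) := by
  have h1 := reachable_quotient_of_reachable ends (clusterFlip ends a fun l => !z l) zN h
  have hcfg : (fun l : {l // zN l = false} => clusterFlip ends a (fun l => !z l) l.1) =
      clusterFlip (fun l : {l // zN l = false} => (ends l.1).map (openGraph (labelledOpen ends zN)).connectedComponentMk)
        ((openGraph (labelledOpen ends zN)).connectedComponentMk a) (fun l => !z l.1) := by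
    funext l
    obtain ⟨b, hb⟩ := l
    exact (flat_quotient_apply ends z zN hN a b hb).symm
  rw [hcfg] at h1
  exact h1

/-! ### 3. Skeleton classes and forests of the contraction -/

/-- **The restriction of a member of the skeleton class of `zN` is a FOREST configuration of `H/zN`**: every open non-skeleton label
(a bridge of `z`) joins two distinct contracted vertices and separates them once closed. [this work] -/
theorem forest_restrict_of_skeleton [DecidableEq α] (z zN : α → Bool)
    (hN : ∀ l, zN l = true → z l = true)
    (hbr : ∀ l, zN l = false → z l = true →
      ∀ x y, ends l = s(x, y) → ¬ (openGraph (labelledOpen ends (Function.update z l false))).Reachable x y) :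
    ∀ b : {l // zN l = false}, (fun l : {l // zN l = false} => z l.1) b = true →
      ∀ X Y, (fun l : {l // zN l = false} => (ends l.1).map (openGraph (labelledOpen ends zN)).connectedComponentMk) b = s(X, Y) →
        X ≠ Y ∧ ¬ (openGraph (labelledOpen
          (fun l : {l // zN l = false} => (ends l.1).map (openGraph (labelledOpen ends zN)).connectedComponentMk)
          (Function.update (fun l : {l // zN l = false} => z l.1) b false))).Reachable X Y := by
  set GN := openGraph (labelledOpen ends zN) with hGN
  rintro ⟨b, hb⟩ hzb X Y hXY
  obtain ⟨⟨u, v⟩, huv⟩ := Quot.exists_rep (ends b)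
  have he : ends b = s(u, v) := huv.symm
  have hmap : s(GN.connectedComponentMk u, GN.connectedComponentMk v) = s(X, Y) := by
    rw [← hXY]; simp [he]
  have hbridge := hbr b hb hzb u v he
  -- the endpoints lie in different contracted vertices
  have hne : GN.connectedComponentMk u ≠ GN.connectedComponentMk v := by
    intro hc
    refine hbridge (reachable_of_le ends (fun l hl => ?_) (SimpleGraph.ConnectedComponent.exact hc))
    have hlb : l ≠ b := by rintro rfl; rw [hb] at hl; exact Bool.noConfusion hl
    rw [Function.update_of_ne hlb]; exact hN l hl
  -- and are separated in the contraction once the label is closed (lift)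
  have hN' : ∀ l, zN l = true → Function.update z b false l = true := by
    intro l hl
    have hlb : l ≠ b := by rintro rfl; rw [hb] at hl; exact Bool.noConfusion hl
    rw [Function.update_of_ne hlb]; exact hN l hl
  have hsep : ¬ (openGraph (labelledOpen
      (fun l : {l // zN l = false} => (ends l.1).map GN.connectedComponentMk)
      (Function.update (fun l : {l // zN l = false} => z l.1) ⟨b, hb⟩ false))).Reachable
        (GN.connectedComponentMk u) (GN.connectedComponentMk v) := by
    rw [← restrict_update z zN hb false]
    intro hr
    exact hbridge (reachable_of_reachable_quotient ends (Function.update z b false) zN hN' hr)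
  rcases Sym2.eq_iff.1 hmap with ⟨h1, h2⟩ | ⟨h1, h2⟩
  · rw [← h1, ← h2]; exact ⟨hne, hsep⟩
  · rw [← h1, ← h2]; exact ⟨hne.symm, fun hr => hsep hr.symm⟩

/-- Members of a skeleton class are determined by their restrictions. [folklore] -/
theorem eq_of_restrict_eq (z₁ z₂ zN : α → Bool) (h₁ : ∀ l, zN l = true → z₁ l = true) (h₂ : ∀ l, zN l = true → z₂ l = true)
    (h : (fun l : {l // zN l = false} => z₁ l.1) = fun l => z₂ l.1) : z₁ = z₂ := by
  funext l
  by_cases hl : zN l = true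
  · rw [h₁ l hl, h₂ l hl]
  · have hl' : zN l = false := by cases h' : zN l <;> simp_all
    exact congrFun h ⟨l, hl'⟩

/-- The restriction of the extension of `z'` by the skeleton is `z'`. [folklore] -/
theorem restrict_extension (zN : α → Bool) (z' : {l // zN l = false} → Bool) :
    (fun l : {l // zN l = false} => (fun b => if h : zN b = false then z' ⟨b, h⟩ else true) l.1) = z' := by
  funext l
  obtain ⟨b, hb⟩ := l
  simp [hb]

/-- The extension by the skeleton of the restriction of a configuration containing the skeleton is the configuration. [folklore] -/
theorem extension_restrict (z zN : α → Bool) (hN : ∀ l, zN l = true → z l = true) :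
    (fun b => if h : zN b = false then (fun l : {l // zN l = false} => z l.1) ⟨b, h⟩ else true) = z := by
  funext b
  by_cases hb : zN b = false
  · simp [hb]
  · have hb' : zN b = true := by cases h' : zN b <;> simp_all
    simp [hb', hN b hb']

/-- **Extension, skeleton part.**  If the skeleton `zN` is closed (every open label of `zN` has its endpoints joined in `zN` minus the label),
then in the extension of any `z'` by `zN` every skeleton label is an open non-bridge. [this work] -/
theorem extension_skeleton [DecidableEq α] (zN : α → Bool)
    (hcl : ∀ l, zN l = true → ∀ x y, ends l = s(x, y) → (openGraph (labelledOpen ends (Function.update zN l false))).Reachable x y)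
    (z' : {l // zN l = false} → Bool) :
    ∀ l, zN l = true → (fun b => if h : zN b = false then z' ⟨b, h⟩ else true) l = true ∧
      ∀ x y, ends l = s(x, y) → (openGraph (labelledOpen ends
        (Function.update (fun b => if h : zN b = false then z' ⟨b, h⟩ else true) l false))).Reachable x y := by
  intro l hl
  refine ⟨by simp [hl], fun x y hxy => reachable_of_le ends (fun b hb => ?_) (hcl l hl x y hxy)⟩
  by_cases hbl : b = l
  · subst hbl; simp at hb
  · rw [Function.update_of_ne hbl] at hb ⊢
    simp [hb]

/-- **Extension, bridge part.**  In the extension of a FOREST configuration `z'` of `H/zN` by the skeleton `zN`, every open non-skeleton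
label is a bridge. [this work] -/
theorem extension_bridge [DecidableEq α] (zN : α → Bool) (z' : {l // zN l = false} → Bool)
    (hfor : ∀ b : {l // zN l = false}, z' b = true →
      ∀ X Y, (fun l : {l // zN l = false} => (ends l.1).map (openGraph (labelledOpen ends zN)).connectedComponentMk) b = s(X, Y) →
        X ≠ Y ∧ ¬ (openGraph (labelledOpen
          (fun l : {l // zN l = false} => (ends l.1).map (openGraph (labelledOpen ends zN)).connectedComponentMk)
          (Function.update z' b false))).Reachable X Y) :
    ∀ l, zN l = false → (fun b => if h : zN b = false then z' ⟨b, h⟩ else true) l = true →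
      ∀ x y, ends l = s(x, y) → ¬ (openGraph (labelledOpen ends
        (Function.update (fun b => if h : zN b = false then z' ⟨b, h⟩ else true) l false))).Reachable x y := by
  set GN := openGraph (labelledOpen ends zN) with hGN
  set e : α → Bool := fun b => if h : zN b = false then z' ⟨b, h⟩ else true with he
  intro l hl hel x y hxy hr
  have hzl : z' ⟨l, hl⟩ = true := by simpa [he, hl] using hel
  have hproj := reachable_quotient_of_reachable ends (Function.update e l false) zN hr
  rw [restrict_update e zN hl false] at hproj
  have hrest : (fun b : {l // zN l = false} => e b.1) = z' := restrict_extension zN z'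
  rw [hrest] at hproj
  have hends : (fun l : {l // zN l = false} => (ends l.1).map GN.connectedComponentMk) ⟨l, hl⟩ =
      s(GN.connectedComponentMk x, GN.connectedComponentMk y) := by simp [hxy]
  exact (hfor ⟨l, hl⟩ hzl _ _ hends).2 hproj


end ForestSkeleton

end Summit.CriticalPhenomena.PercolationContinuityZ3.Theorems.ProductFormFibre
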